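import Summits.Ventures.LatticeQCDFlow.Exactness.Phi4LocalMetropolisExact
import HarnessLib

/-!
# The single-site Metropolis hit of lattice φ⁴ is reversible: detailed balance, integrated form

HONEST FRAMING: exact (Metropolis-corrected) sampling algorithms for lattice gauge theory;
figures of merit are autocorrelation/cost numbers at stated couplings and volumes; no
continuum-physics claim.  (SCALAR calibration rung S0-A: not a gauge result.)

Venture `LatticeQCDFlow` (cell pub-lqcd), topic `Exactness`; FANOUT row 2 (`s0-phi4`: the LOCAL
arm of the 2D φ⁴ calibration — random-walk Metropolis; battery leg T2a "pointwise detailed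
balance, Metropolis").  NEW WORK of the cell (one Fubini swap on a coordinate line, then Fubini
along the site); nothing is cited as a fact.  Printed counterparts, named only: Metropolis et al.
1953, Hastings 1970, Tierney 1998 (random-walk Metropolis is reversible).

Relation to the tree.  `Exactness/Phi4LocalMetropolisExact.lean` (row 2) proved EXACTNESS of the
hit (`metropolis_site_exact`) from the pointwise density identity `accept_mul_weight`
(`min(1, w t'/w t) ρ(t'−t) w t = s(t,t')`, `s = metroFlow` symmetric for even `ρ`).  Here the same
identity is integrated against a SECOND bounded observable: the hit `M_x` is SELF-ADJOINT on
`L²(e^{−S}dφ)`; exactness is the case `g = 1`.  With `Exactness/Phi4HMCReversible.lean` (HMC) and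
`Exactness/Phi4IndependenceSamplerReversible.lean` (flow IMH), all three S0-A sampler families now
have detailed balance typed in one and the same integrated form.

## What is proved

* §1 (the line).  `metropolis_line_pair` — pointwise expansion
  `(K g)(t)·c·w(t) = ∫ s(t,·) g c + g(t) c w(t) − ∫ s(t,·) g(t) c`;
  **`metropolis_line_symm`** — positive integrable `w`, even probability density `ρ`, bounded
  measurable `g`, `h`: `∫ (K g)·h·w dt = ∫ g·(K h)·w dt`,
  `(K g)(t) = ∫ [min(1, w t'/w t) g(t') + (1 − min(1, w t'/w t)) g(t)] ρ(t' − t) dt'`.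
* §2 (the lattice `Fin (n+1) → ℝ`).  **`metropolis_site_reversible`** — coercive action (every
  `λ > 0`, any real `J`), even proposal density `ρ`, every site `x`, bounded measurable `f`, `g`:
  `∫ (M_x f)·g·e^{−S} dφ = ∫ f·(M_x g)·e^{−S} dφ` (Fubini along `x`: on each coordinate line the
  lattice operator IS the one-dimensional kernel with the line weight `t ↦ e^{−S(φ|φ_x:=t)}`);
  **`metropolis_site_reversible_phi4`** — EVERY `λ > 0`, EVERY real `J`, every site, every even
  step law: `⟨(M_x f) g⟩ = ⟨f (M_x g)⟩` in the φ⁴ Gibbs law.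

NOT CLAIMED: reversibility of an ORDERED sweep (a product of self-adjoint hits is not self-adjoint;
its adjoint is the reversed sweep — `Exactness/SequentialScanAdjoint.lean`, row 9, finite case);
spectral gaps; unbounded observables.
-/

namespace Summit.Ventures.LatticeQCDFlow.Exactness

open Real MeasureTheory Finset Filter
open Summit.Ventures.LatticeQCDFlow.Scoring

/-! ## §1 Random-walk Metropolis on the line is self-adjoint on `L²(w dt)` -/

section Line

/-- **Pointwise expansion of the paired integrand** (the rejected mass is diagonal):
`(K g)(t)·c·w(t) = ∫ s(t,t') g(t') c dt' + g(t) c w(t) − ∫ s(t,t') g(t) c dt'`. -/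
theorem metropolis_line_pair {w ρ g : ℝ → ℝ} (hw0 : ∀ t, 0 < w t) (hwm : Measurable w)
    (hρ0 : ∀ u, 0 ≤ ρ u) (hρm : Measurable ρ) (hρi : Integrable ρ) (hρ1 : ∫ u, ρ u = 1)
    (hgm : Measurable g) {B : ℝ} (hgb : ∀ t, |g t| ≤ B) (t c : ℝ) :
    (∫ t', (min 1 (w t' / w t) * g t' + (1 - min 1 (w t' / w t)) * g t) * ρ (t' - t)) * c * w t
      = (∫ t', metroFlow w ρ t t' * g t' * c) + g t * c * w t
        - ∫ t', metroFlow w ρ t t' * g t * c := by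
  have ha_le : ∀ t', min (1 : ℝ) (w t' / w t) ≤ 1 := fun t' => min_le_left _ _
  have ha_nn : ∀ t', 0 ≤ min (1 : ℝ) (w t' / w t) :=
    fun t' => le_min zero_le_one (div_nonneg (hw0 t').le (hw0 t).le)
  have hρt : Integrable (fun t' => ρ (t' - t)) := hρi.comp_sub_right t
  have ham : Measurable fun t' => min (1 : ℝ) (w t' / w t) := measurable_const.min (hwm.div_const (w t))
  have hρm' : Measurable fun t' => ρ (t' - t) := hρm.comp (measurable_id.sub_const t)
  have hI1 : Integrable (fun t' => min 1 (w t' / w t) * g t' * ρ (t' - t)) := by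
    refine Integrable.mono' (hρt.const_mul B) ((ham.mul hgm).mul hρm').aestronglyMeasurable
      (Eventually.of_forall fun t' => ?_)
    rw [Real.norm_eq_abs, abs_mul, abs_mul, abs_of_nonneg (ha_nn t'), abs_of_nonneg (hρ0 _)]
    calc min 1 (w t' / w t) * |g t'| * ρ (t' - t) ≤ 1 * B * ρ (t' - t) := by
          gcongr
          · exact hρ0 _
          · exact ha_le t'
          · exact hgb t'
      _ = B * ρ (t' - t) := by ring
  have hI3 : Integrable (fun t' => min 1 (w t' / w t) * g t * ρ (t' - t)) := by
    refine Integrable.mono' (hρt.const_mul B) ((ham.mul measurable_const).mul hρm').aestronglyMeasurable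
      (Eventually.of_forall fun t' => ?_)
    rw [Real.norm_eq_abs, abs_mul, abs_mul, abs_of_nonneg (ha_nn t'), abs_of_nonneg (hρ0 _)]
    calc min 1 (w t' / w t) * |g t| * ρ (t' - t) ≤ 1 * B * ρ (t' - t) := by
          gcongr
          · exact hρ0 _
          · exact ha_le t'
          · exact hgb t
      _ = B * ρ (t' - t) := by ring
  have hI2 : Integrable (fun t' => (1 - min 1 (w t' / w t)) * g t * ρ (t' - t)) := by
    have e : (fun t' => (1 - min 1 (w t' / w t)) * g t * ρ (t' - t))
        = fun t' => g t * ρ (t' - t) - min 1 (w t' / w t) * g t * ρ (t' - t) := by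
      funext t'; ring
    rw [e]
    exact (hρt.const_mul (g t)).sub hI3
  have hsplit : ∀ t', (min 1 (w t' / w t) * g t' + (1 - min 1 (w t' / w t)) * g t) * ρ (t' - t)
      = min 1 (w t' / w t) * g t' * ρ (t' - t) + (1 - min 1 (w t' / w t)) * g t * ρ (t' - t) :=
    fun t' => by ring
  simp only [hsplit]
  rw [integral_add hI1 hI2]
  have hsplit2 : ∀ t', (1 - min 1 (w t' / w t)) * g t * ρ (t' - t)
      = g t * ρ (t' - t) - min 1 (w t' / w t) * g t * ρ (t' - t) := fun t' => by ring
  simp only [hsplit2]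
  rw [integral_sub (hρt.const_mul (g t)) hI3, integral_const_mul,
    integral_sub_right_eq_self (μ := (volume : Measure ℝ)) ρ t, hρ1, mul_one]
  have e1 : (∫ t', min 1 (w t' / w t) * g t' * ρ (t' - t)) * c * w t
      = ∫ t', metroFlow w ρ t t' * g t' * c := by
    rw [mul_assoc, ← integral_mul_const]
    refine integral_congr_ae (Eventually.of_forall fun t' => ?_)
    dsimp only
    rw [← accept_mul_weight w ρ (hw0 t) t']
    ring
  have e3 : (∫ t', min 1 (w t' / w t) * g t * ρ (t' - t)) * c * w t
      = ∫ t', metroFlow w ρ t t' * g t * c := by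
    rw [mul_assoc, ← integral_mul_const]
    refine integral_congr_ae (Eventually.of_forall fun t' => ?_)
    dsimp only
    rw [← accept_mul_weight w ρ (hw0 t) t']
    ring
  rw [← e1, ← e3]
  ring

/-- **RANDOM-WALK METROPOLIS ON THE LINE IS SELF-ADJOINT ON `L²(w dt)`.**  For a positive
integrable weight `w`, an even probability density `ρ` and bounded measurable `g`, `h`:
`∫ (K g)·h·w dt = ∫ g·(K h)·w dt`. -/
theorem metropolis_line_symm {w ρ g h : ℝ → ℝ} (hw0 : ∀ t, 0 < w t) (hwm : Measurable w)
    (hwi : Integrable w) (hρ0 : ∀ u, 0 ≤ ρ u) (hρm : Measurable ρ) (hρi : Integrable ρ)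
    (hρ1 : ∫ u, ρ u = 1) (hρs : ∀ u, ρ (-u) = ρ u) (hgm : Measurable g) (hhm : Measurable h)
    {Bg Bh : ℝ} (hgb : ∀ t, |g t| ≤ Bg) (hhb : ∀ t, |h t| ≤ Bh) :
    ∫ t, (∫ t', (min 1 (w t' / w t) * g t' + (1 - min 1 (w t' / w t)) * g t) * ρ (t' - t))
        * h t * w t
      = ∫ t, g t * (∫ t', (min 1 (w t' / w t) * h t' + (1 - min 1 (w t' / w t)) * h t)
        * ρ (t' - t)) * w t := by
  have hG := integrable_weight_mul_proposal hwm hwi (fun t => (hw0 t).le) hρm hρi hρ0 hρ1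
  have hsm : Measurable fun p : ℝ × ℝ => metroFlow w ρ p.1 p.2 := by
    unfold metroFlow
    exact ((hwm.comp measurable_fst).min (hwm.comp measurable_snd)).mul
      (hρm.comp (measurable_snd.sub measurable_fst))
  have hs_le : ∀ t t', |metroFlow w ρ t t'| ≤ w t * ρ (t' - t) := by
    intro t t'
    unfold metroFlow
    rw [abs_of_nonneg (mul_nonneg (le_min (hw0 t).le (hw0 t').le) (hρ0 _))]
    exact mul_le_mul_of_nonneg_right (min_le_left _ _) (hρ0 _)
  -- generic integrability of `s(t,t') · a(t') · b(t)` for bounded measurable `a`, `b`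
  have hprod : ∀ {a b : ℝ → ℝ}, Measurable a → Measurable b → ∀ {Ba Bb : ℝ},
      (∀ t, |a t| ≤ Ba) → (∀ t, |b t| ≤ Bb) →
      Integrable (fun p : ℝ × ℝ => metroFlow w ρ p.1 p.2 * a p.2 * b p.1)
        ((volume : Measure ℝ).prod volume) := by
    intro a b ham hbm Ba Bb hab hbb
    refine Integrable.mono' (hG.const_mul (Ba * Bb))
      ((hsm.mul (ham.comp measurable_snd)).mul (hbm.comp measurable_fst)).aestronglyMeasurable
      (Eventually.of_forall fun p => ?_)
    have hBa : 0 ≤ Ba := (abs_nonneg _).trans (hab p.2)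
    rw [Real.norm_eq_abs, abs_mul, abs_mul]
    calc |metroFlow w ρ p.1 p.2| * |a p.2| * |b p.1| ≤ (w p.1 * ρ (p.2 - p.1)) * Ba * Bb := by
          have h1 : |metroFlow w ρ p.1 p.2| * |a p.2| ≤ (w p.1 * ρ (p.2 - p.1)) * Ba :=
            mul_le_mul (hs_le _ _) (hab _) (abs_nonneg _) (mul_nonneg (hw0 _).le (hρ0 _))
          exact mul_le_mul h1 (hbb _) (abs_nonneg _)
            (mul_nonneg (mul_nonneg (hw0 _).le (hρ0 _)) hBa)
      _ = Ba * Bb * (w p.1 * ρ (p.2 - p.1)) := by ring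
  have hL : ∀ t, (∫ t', (min 1 (w t' / w t) * g t' + (1 - min 1 (w t' / w t)) * g t) * ρ (t' - t))
      * h t * w t
      = (∫ t', metroFlow w ρ t t' * g t' * h t) + g t * h t * w t
        - ∫ t', metroFlow w ρ t t' * g t * h t :=
    fun t => metropolis_line_pair hw0 hwm hρ0 hρm hρi hρ1 hgm hgb t (h t)
  have hR : ∀ t, g t * (∫ t', (min 1 (w t' / w t) * h t' + (1 - min 1 (w t' / w t)) * h t)
      * ρ (t' - t)) * w t
      = (∫ t', metroFlow w ρ t t' * h t' * g t) + h t * g t * w t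
        - ∫ t', metroFlow w ρ t t' * h t * g t := by
    intro t
    rw [← metropolis_line_pair hw0 hwm hρ0 hρm hρi hρ1 hhm hhb t (g t)]
    ring
  simp only [hL, hR]
  have hF1 := hprod hgm hhm hgb hhb
  have hF2 := hprod hhm hgm hhb hgb
  have hgh : ∀ t, |g t * h t| ≤ Bg * Bh := fun t => by
    rw [abs_mul]
    exact mul_le_mul (hgb t) (hhb t) (abs_nonneg _) ((abs_nonneg _).trans (hgb t))
  have hF3 : Integrable (fun p : ℝ × ℝ => metroFlow w ρ p.1 p.2 * (1 : ℝ) * (g p.1 * h p.1))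
      ((volume : Measure ℝ).prod volume) :=
    hprod measurable_const (hgm.mul hhm) (Ba := 1) (fun _ => by simp) hgh
  have hI1t : Integrable (fun t => ∫ t', metroFlow w ρ t t' * g t' * h t) := hF1.integral_prod_left
  have hI2t : Integrable (fun t => ∫ t', metroFlow w ρ t t' * h t' * g t) := hF2.integral_prod_left
  have hI3t : Integrable (fun t => ∫ t', metroFlow w ρ t t' * g t * h t) := by
    refine hF3.integral_prod_left.congr (Eventually.of_forall fun t => ?_)
    refine integral_congr_ae (Eventually.of_forall fun t' => ?_)
    dsimp only
    ring
  have hI3t' : Integrable (fun t => ∫ t', metroFlow w ρ t t' * h t * g t) := by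
    refine hI3t.congr (Eventually.of_forall fun t => ?_)
    refine integral_congr_ae (Eventually.of_forall fun t' => ?_)
    dsimp only
    ring
  have hDm : Integrable (fun t => g t * h t * w t) := by
    refine Integrable.mono' (hwi.const_mul (Bg * Bh)) ((hgm.mul hhm).mul hwm).aestronglyMeasurable
      (Eventually.of_forall fun t => ?_)
    rw [Real.norm_eq_abs, abs_mul, abs_of_pos (hw0 t)]
    exact mul_le_mul_of_nonneg_right (hgh t) (hw0 t).le
  have hDm' : Integrable (fun t => h t * g t * w t) := by
    refine hDm.congr (Eventually.of_forall fun t => ?_)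
    dsimp only
    ring
  have hA1 : Integrable (fun t => (∫ t', metroFlow w ρ t t' * g t' * h t) + g t * h t * w t) :=
    hI1t.add hDm
  have hA2 : Integrable (fun t => (∫ t', metroFlow w ρ t t' * h t' * g t) + h t * g t * w t) :=
    hI2t.add hDm'
  rw [integral_sub hA1 hI3t, integral_add hI1t hDm, integral_sub hA2 hI3t', integral_add hI2t hDm']
  have hdiag1 : ∫ t, g t * h t * w t = ∫ t, h t * g t * w t := by
    refine integral_congr_ae (Eventually.of_forall fun t => ?_)
    dsimp only
    ring
  have hdiag2 : ∫ t, ∫ t', metroFlow w ρ t t' * g t * h t = ∫ t, ∫ t', metroFlow w ρ t t' * h t * g t := by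
    refine integral_congr_ae (Eventually.of_forall fun t => ?_)
    refine integral_congr_ae (Eventually.of_forall fun t' => ?_)
    dsimp only
    ring
  have hswap : ∫ t, ∫ t', metroFlow w ρ t t' * g t' * h t
      = ∫ t, ∫ t', metroFlow w ρ t t' * h t' * g t := by
    rw [integral_integral_swap hF1]
    refine integral_congr_ae (Eventually.of_forall fun t' => ?_)
    refine integral_congr_ae (Eventually.of_forall fun t => ?_)
    dsimp only
    rw [metroFlow_symm w ρ hρs t t']
    ring
  rw [hdiag1, hdiag2, hswap]

end Line

/-! ## §2 The lattice: the Metropolis hit for φ⁴ satisfies detailed balance -/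

section Lattice

variable {n : ℕ}

/-- **THE SINGLE-SITE METROPOLIS HIT IS REVERSIBLE FOR LATTICE φ⁴ ON `ℝ^Λ`.**  Coercive action
(every `λ > 0` with any real `J`, incl. `m² = −4`; or a positive-definite free field), even
proposal density `ρ`, every site `x`, bounded measurable `f`, `g`:
`∫ (M_x f)·g·e^{−S} dφ = ∫ f·(M_x g)·e^{−S} dφ`. -/
theorem metropolis_site_reversible {J : Fin (n + 1) → Fin (n + 1) → ℝ} {lam ε K : ℝ} (hε : 0 < ε)
    (hS : ∀ φ : Fin (n + 1) → ℝ, ε * ∑ w, φ w ^ 2 - K ≤ latticePhi4Action J lam φ)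
    (x : Fin (n + 1)) {ρ : ℝ → ℝ} (hρ0 : ∀ u, 0 ≤ ρ u) (hρm : Measurable ρ) (hρi : Integrable ρ)
    (hρ1 : ∫ u, ρ u = 1) (hρs : ∀ u, ρ (-u) = ρ u) {f g : (Fin (n + 1) → ℝ) → ℝ}
    (hfm : Measurable f) (hgm : Measurable g) {Bf Bg : ℝ} (hfb : ∀ φ, |f φ| ≤ Bf)
    (hgb : ∀ φ, |g φ| ≤ Bg) :
    ∫ φ, metroSite J lam ρ x f φ * g φ * gibbsWeight J lam φ
      = ∫ φ, f φ * metroSite J lam ρ x g φ * gibbsWeight J lam φ := by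
  have hw_int : Integrable (gibbsWeight J lam) := integrable_gibbsWeight_of_coercive hε hS
  have hwc := (continuous_gibbsWeight J lam).aestronglyMeasurable (μ := volume)
  have hBf : ∀ φ : Fin (n + 1) → ℝ, 0 ≤ Bf := fun φ => (abs_nonneg _).trans (hfb φ)
  have hG1 : Integrable (fun φ => metroSite J lam ρ x f φ * g φ * gibbsWeight J lam φ) := by
    refine Integrable.mono' (hw_int.const_mul (Bf * Bg))
      (((measurable_metroSite J lam hρm x hfm).aestronglyMeasurable.mul hgm.aestronglyMeasurable).mul
        hwc) (Eventually.of_forall fun φ => ?_)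
    rw [Real.norm_eq_abs, abs_mul, abs_mul, abs_of_pos (gibbsWeight_pos J lam φ)]
    refine mul_le_mul_of_nonneg_right ?_ (gibbsWeight_pos J lam φ).le
    exact mul_le_mul (abs_metroSite_le J lam hρ0 hρi hρ1 x hfb φ) (hgb φ) (abs_nonneg _) (hBf φ)
  have hG2 : Integrable (fun φ => f φ * metroSite J lam ρ x g φ * gibbsWeight J lam φ) := by
    refine Integrable.mono' (hw_int.const_mul (Bf * Bg))
      ((hfm.aestronglyMeasurable.mul (measurable_metroSite J lam hρm x hgm).aestronglyMeasurable).mul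
        hwc) (Eventually.of_forall fun φ => ?_)
    rw [Real.norm_eq_abs, abs_mul, abs_mul, abs_of_pos (gibbsWeight_pos J lam φ)]
    refine mul_le_mul_of_nonneg_right ?_ (gibbsWeight_pos J lam φ).le
    exact mul_le_mul (hfb φ) (abs_metroSite_le J lam hρ0 hρi hρ1 x hgb φ) (abs_nonneg _) (hBf φ)
  rw [integral_eq_integral_insertNth x hG1, integral_eq_integral_insertNth x hG2]
  refine integral_congr_ae (Eventually.of_forall fun x' => ?_)
  set ψ : Fin (n + 1) → ℝ := Fin.insertNth x (0 : ℝ) x' with hψ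
  have hψx : ψ x = 0 := by simp [hψ]
  have hins : ∀ t : ℝ, (Fin.insertNth x t x' : Fin (n + 1) → ℝ) = Function.update ψ x t :=
    fun t => insertNth_eq_update x t x'
  simp only [hins]
  set w : ℝ → ℝ := fun t => gibbsWeight J lam (Function.update ψ x t) with hw
  have hw0 : ∀ t, 0 < w t := fun t => gibbsWeight_pos J lam _
  have hwm : Measurable w :=
    ((continuous_gibbsWeight J lam).measurable.comp
      (measurable_update' (a := x) |>.comp (measurable_const.prodMk measurable_id)))
  have hwi : Integrable w := integrable_gibbsWeight_line hε hS ψ x hψx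
  have hfl : Measurable fun t => f (Function.update ψ x t) :=
    hfm.comp (measurable_update' (a := x) |>.comp (measurable_const.prodMk measurable_id))
  have hgl : Measurable fun t => g (Function.update ψ x t) :=
    hgm.comp (measurable_update' (a := x) |>.comp (measurable_const.prodMk measurable_id))
  have key := metropolis_line_symm hw0 hwm hwi hρ0 hρm hρi hρ1 hρs hfl hgl
    (fun t => hfb _) (fun t => hgb _)
  -- the lattice operator along the line IS the one-dimensional kernel (for `f` and for `g`)
  have hK : ∀ (k : (Fin (n + 1) → ℝ) → ℝ) (t : ℝ), metroSite J lam ρ x k (Function.update ψ x t)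
      = ∫ t', (min 1 (w t' / w t) * k (Function.update ψ x t')
          + (1 - min 1 (w t' / w t)) * k (Function.update ψ x t)) * ρ (t' - t) := by
    intro k t
    unfold metroSite metroAccept
    simp only [Function.update_idem, Function.update_self, hw]
  simp only [hK]
  exact key

/-- **Every `λ > 0`, every real coupling matrix, every site, every even step law**:
`⟨(M_x f) g⟩ = ⟨f (M_x g)⟩` in the φ⁴ Gibbs law — detailed balance of the local sampler. -/
theorem metropolis_site_reversible_phi4 {lam : ℝ} (hlam : 0 < lam)
    (J : Fin (n + 1) → Fin (n + 1) → ℝ) (x : Fin (n + 1)) {ρ : ℝ → ℝ} (hρ0 : ∀ u, 0 ≤ ρ u)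
    (hρm : Measurable ρ) (hρi : Integrable ρ) (hρ1 : ∫ u, ρ u = 1) (hρs : ∀ u, ρ (-u) = ρ u)
    {f g : (Fin (n + 1) → ℝ) → ℝ} (hfm : Measurable f) (hgm : Measurable g) {Bf Bg : ℝ}
    (hfb : ∀ φ, |f φ| ≤ Bf) (hgb : ∀ φ, |g φ| ≤ Bg) :
    gibbsExpect J lam (fun φ => metroSite J lam ρ x f φ * g φ)
      = gibbsExpect J lam (fun φ => f φ * metroSite J lam ρ x g φ) := by
  unfold gibbsExpect
  rw [metropolis_site_reversible one_pos (latticePhi4Action_coercive hlam J) x hρ0 hρm hρi hρ1 hρs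
    hfm hgm hfb hgb]

end Lattice

end Summit.Ventures.LatticeQCDFlow.Exactness
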